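import Summits.ResolutionOfSingularities.ResolutionOfSingularities.Theorems.PurelyInseparableDim4ResConeTwoSlotBoundary
import Summits.ResolutionOfSingularities.ResolutionOfSingularities.Theorems.PurelyInseparableDim4ResConeLSectorKill
import HarnessLib
import HarnessLib.Audit.Tags

/-!
# Purely inseparable four-folds — TWO-SLOT TAIL: ONE ROTATION STEP, AND THE L-SECTOR PERSISTS THROUGH ROTATIONS
# (cell `res-dim4-pi`, K2(p) lane, slice B brick K24a-L′, file 1 of 2)

[OURS · counted 0 · cell `res-dim4-pi` · K2(p) lane (holder res-dim4-p-12 g3, «K24a-L′ = `no_twoSlot_tail_five_L`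
WITHOUT `hslot`», bus 2026-08-29 04:35:53Z; riders of res-dim4-crit-4 g4 04:39:55Z); seat res-dim4-p-2 g5 over
res-dim4-p-1 g4's `…ResConeTwoSlotBoundary` (`r_succ_eq_of_slot`, `exists_slot_letters`, `translation_eq_single`), the
holder's `…ResConeLSectorKill` (`triple_apply`, `degree_triple`) and res-dim4-p-9 g3's `step_r_univ'`.]  Nothing here
proves K2(p)/K2(5), `NoIsolatedTrap p p` or resolution of singularities in dimension ≥ 4 / characteristic `p`.  AI kernel
work, weaker than expert review.

THE REGIME.  (T2) of the light `d = 3` tail at `p = 5` (weights `≤ 1`, `|r| = 3`, orders `q + 1 = 6`): an idle boundary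
letter `ν`, boundary `e_A + e_B + e_ν` with two SLOT letters and one FREE letter `f`; a step is either a SLOT step (chart
`A` or `B`, translation along `f`, boundary kept — p-1's `r_succ_eq_of_slot`) or a ROTATION (chart `f`).  Here:

* §1 `eq_free_of_apply_eq_zero` (the free letter is unique), `slot_or_free`, and **`r_succ_of_rotation`** — the boundary
  bookkeeping of ONE ROTATION STEP that keeps `|r|`: it translates exactly one slot `L` (`b_k = (b_k L)·e_L`,
  `b_k L ≠ 0`), which becomes free, and `r_{k+1} = e_f + e_{other slot} + e_ν`; `r_succ_of_slot'` (the slot step, dressed).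
* §2 **`lSector_persists_rot`** — if `ℓ_k` satisfies the direction equation `ℓ_k (j k) + ℓ_k ⬝ b_k = 0` and propagates
  off the chart (`ℓ_{k+1} i = λ_k ℓ_k i`, `i ≠ j k`), and `ℓ_{k₁}` vanishes at the free letter, then `ℓ_k` vanishes at
  the free letter of time `k` for every `k ≥ k₁`: a slot step keeps the free letter; a rotation losing `L` has `ℓ_k L = 0`
  by the direction equation, and `L` is the new free letter.  (p-1's `lSector_persists`/`tSector_persists` cover slot
  steps only.)

Part 2 (`…ResConeTwoSlotTailL`): the two-step deaths at a satellite step and `no_twoSlot_tail_five_L`.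
[cite: CossartJannsenSaito2020, Thm. 3.14] [cite: HauserPerlega2019PRIMS, §2 (transform D' of D)]
bears_on: LADDER-RESOLUTION:D157-DOOR2 (res-dim4-pi · K2(p) · slice B · K24a-L′).  Supports
stmt-ResolutionOfSingularities-16155 (helper).
-/

set_option linter.dupNamespace false -- mandated namespace of this single-conjunct summit

noncomputable section

namespace Summit.ResolutionOfSingularities.ResolutionOfSingularities.Theorems.PIDim4

namespace ResCone

open MvPolynomial Finset
open Literature.AlgebraicGeometry.Resolution
open Literature.AlgebraicGeometry.Resolution.CentreBlowup
open Literature.AlgebraicGeometry.Resolution.Hauser2010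
open Literature.AlgebraicGeometry.Resolution.HauserPerlega2019

variable {K : Type} [Field K]

/-! ## 1. Letters, and one rotation step -/

/-- **The free letter is unique**: with `r = e_A + e_B + e_ν`, `r i = 0` forces `i = f`. [folklore] -/
theorem eq_free_of_apply_eq_zero {A B ν f : Fin 4} (hAB : A ≠ B) (hAν : A ≠ ν) (hAf : A ≠ f) (hBν : B ≠ ν)
    (hBf : B ≠ f) (hνf : ν ≠ f) {r : Fin 4 →₀ ℕ}
    (hr : r = Finsupp.single A 1 + Finsupp.single B 1 + Finsupp.single ν 1) {i : Fin 4} (hi : r i = 0) :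
    i = f := by
  have hq := triple_apply hAB hAν hAf hBν hBf hνf
  rcases letters_exhaust hAB hAν hAf hBν hBf hνf i with h | h | h | h
  · subst h; rw [hr, hq.1] at hi; exact absurd hi one_ne_zero
  · subst h; rw [hr, hq.2.1] at hi; exact absurd hi one_ne_zero
  · subst h; rw [hr, hq.2.2.1] at hi; exact absurd hi one_ne_zero
  · exact h

/-- **A chart off the idle letter is a slot letter or the free letter.** [folklore] -/
theorem slot_or_free {A B ν f : Fin 4} (hAB : A ≠ B) (hAν : A ≠ ν) (hAf : A ≠ f) (hBν : B ≠ ν) (hBf : B ≠ f)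
    (hνf : ν ≠ f) {i : Fin 4} (hiν : i ≠ ν) : (i = A ∨ i = B) ∨ i = f := by
  rcases letters_exhaust hAB hAν hAf hBν hBf hνf i with h | h | h | h
  · exact Or.inl (Or.inl h)
  · exact Or.inl (Or.inr h)
  · exact absurd h hiν
  · exact Or.inr h

section Steps

variable [DecidableEq K]

/-- **ONE ROTATION STEP LOSES EXACTLY ONE SLOT.**  On a witnessed chain with `ord₀ F_k = q + 1` and boundary
`r_k = e_A + e_B + e_ν` (letters pairwise distinct, `f` free), if step `k` is taken in the chart of the FREE letter
(`j k = f`), does not translate `ν`, and keeps `|r|` (`|r_{k+1}| = |r_k|`), then it translates exactly one slot `L`: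
`b_k = (b_k L)·e_L` with `b_k L ≠ 0`, and `r_{k+1} = e_f + e_{other slot} + e_ν`. [OURS]
[cite: HauserPerlega2019PRIMS, §2 (transform D' of D)] -/
theorem r_succ_of_rotation (q : ℕ) {c : ℕ → State K} {j : ℕ → Fin 4} {b : ℕ → Fin 4 → K}
    (hw : FreeTail.IsWitnessedChain q c j b) {k : ℕ} (ho : ordZero (c k).F = ((q + 1 : ℕ) : ℕ∞))
    (hdeg : (c (k + 1)).r.degree = (c k).r.degree) {A B ν f : Fin 4} (hAB : A ≠ B) (hAν : A ≠ ν) (hAf : A ≠ f)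
    (hBν : B ≠ ν) (hBf : B ≠ f) (hνf : ν ≠ f)
    (hr : (c k).r = Finsupp.single A 1 + Finsupp.single B 1 + Finsupp.single ν 1) (hjf : j k = f)
    (hbν : b k ν = 0) :
    (b k A ≠ 0 ∧ b k = Pi.single A (b k A) ∧
        (c (k + 1)).r = Finsupp.single f 1 + Finsupp.single B 1 + Finsupp.single ν 1) ∨
      (b k B ≠ 0 ∧ b k = Pi.single B (b k B) ∧
        (c (k + 1)).r = Finsupp.single f 1 + Finsupp.single A 1 + Finsupp.single ν 1) := by
  have hbf : b k f = 0 := by rw [← hjf]; exact (hw k).2.1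
  have hck : c (k + 1) = CentreBlowup.step q Finset.univ (j k) (b k) (c k) := (hw k).2.2.2.2
  have hr' : (c (k + 1)).r = ((c k).r.filter (fun i => b k i = 0)).update f 1 := by
    rw [hck, step_r_univ' q (j k) (b k) (c k) ho, show q + 1 - q = 1 by omega, hjf]
  have hq := triple_apply hAB hAν hAf hBν hBf hνf
  -- pointwise values of the new boundary
  have hvA : (c (k + 1)).r A = if b k A = 0 then 1 else 0 := by
    rw [hr', Finsupp.update_apply, if_neg hAf, Finsupp.filter_apply, hr, hq.1]
  have hvB : (c (k + 1)).r B = if b k B = 0 then 1 else 0 := by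
    rw [hr', Finsupp.update_apply, if_neg hBf, Finsupp.filter_apply, hr, hq.2.1]
  have hvν : (c (k + 1)).r ν = 1 := by
    rw [hr', Finsupp.update_apply, if_neg hνf, Finsupp.filter_apply, if_pos hbν, hr, hq.2.2.1]
  have hvf : (c (k + 1)).r f = 1 := by
    rw [hr', Finsupp.update_apply, if_pos rfl]
  -- the degree count: exactly one slot survives
  have hdeg3 : (c k).r.degree = 3 := by rw [hr]; exact degree_triple A B ν
  have hr4 := eq_sum_single_four hAB hAν hAf hBν hBf hνf (c (k + 1)).r
  have hdeg4 : (c (k + 1)).r.degree = (c (k + 1)).r A + (c (k + 1)).r B + (c (k + 1)).r ν + (c (k + 1)).r f := by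
    conv_lhs => rw [hr4]
    exact degree_quad A B ν f _ _ _ _
  rw [hdeg, hdeg3, hvν, hvf] at hdeg4
  by_cases hA : b k A = 0
  · -- `A` survives, `B` is lost
    rw [hvA, if_pos hA] at hdeg4
    have hB : b k B ≠ 0 := by
      intro hB
      rw [hvB, if_pos hB] at hdeg4
      exact absurd hdeg4 (by norm_num)
    refine Or.inr ⟨hB, ?_, ?_⟩
    · funext i
      rcases letters_exhaust hAB hAν hAf hBν hBf hνf i with h | h | h | h
      · subst h; rw [Pi.single_eq_of_ne hAB, hA]
      · subst h; rw [Pi.single_eq_same]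
      · subst h; rw [Pi.single_eq_of_ne hBν.symm, hbν]
      · subst h; rw [Pi.single_eq_of_ne hBf.symm, hbf]
    · rw [hr4, hvA, if_pos hA, hvB, if_neg hB, hvν, hvf, Finsupp.single_zero, add_zero]
      abel
  · -- `A` is lost, `B` survives
    rw [hvA, if_neg hA] at hdeg4
    have hB : b k B = 0 := by
      by_contra hB
      rw [hvB, if_neg hB] at hdeg4
      exact absurd hdeg4 (by norm_num)
    refine Or.inl ⟨hA, ?_, ?_⟩
    · funext i
      rcases letters_exhaust hAB hAν hAf hBν hBf hνf i with h | h | h | h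
      · subst h; rw [Pi.single_eq_same]
      · subst h; rw [Pi.single_eq_of_ne hAB.symm, hB]
      · subst h; rw [Pi.single_eq_of_ne hAν.symm, hbν]
      · subst h; rw [Pi.single_eq_of_ne hAf.symm, hbf]
    · rw [hr4, hvA, if_neg hA, hvB, if_pos hB, hvν, hvf, Finsupp.single_zero, zero_add]
      abel

/-- **ONE SLOT STEP** (p-1's `r_succ_eq_of_slot`, dressed): chart a slot letter `κ` ⇒ the boundary is kept and the
translation is `(b_k f)·e_f`. [OURS] [cite: HauserPerlega2019PRIMS, §2 (transform D' of D)] -/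
theorem r_succ_of_slot' (q : ℕ) {c : ℕ → State K} {j : ℕ → Fin 4} {b : ℕ → Fin 4 → K}
    (hw : FreeTail.IsWitnessedChain q c j b) {k : ℕ} (ho : ordZero (c k).F = ((q + 1 : ℕ) : ℕ∞))
    (hdeg : (c (k + 1)).r.degree = (c k).r.degree) {A B ν f : Fin 4} (hAB : A ≠ B) (hAν : A ≠ ν) (hAf : A ≠ f)
    (hBν : B ≠ ν) (hBf : B ≠ f) (hνf : ν ≠ f)
    (hr : (c k).r = Finsupp.single A 1 + Finsupp.single B 1 + Finsupp.single ν 1) (hjk : j k = A ∨ j k = B) :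
    (c (k + 1)).r = Finsupp.single A 1 + Finsupp.single B 1 + Finsupp.single ν 1 ∧
      b k = Pi.single f (b k f) := by
  have hq := triple_apply hAB hAν hAf hBν hBf hνf
  have hslot : (c k).r (j k) = 1 := by
    rcases hjk with h | h
    · rw [h, hr, hq.1]
    · rw [h, hr, hq.2.1]
  obtain ⟨hr', hb⟩ := r_succ_eq_of_slot q hw ho hdeg hslot
  exact ⟨hr'.trans hr, translation_eq_single hAB hAν hAf hBν hBf hνf hr hb⟩

end Steps

/-! ## 2. The L-sector persists, rotations included -/

/-- **THE L-SECTOR PERSISTS ALONG THE TWO-SLOT TAIL, ROTATIONS INCLUDED.**  Along a witnessed chain with orders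
`q + 1`, weight-`1` boundaries of size `3` through an idle letter `ν` (`1 ≤ r_k ν`, `j k ≠ ν`, `b k ν = 0`) from `k₁`
on, let `ℓ_k` satisfy the direction equation `ℓ_k (j k) + ℓ_k ⬝ b_k = 0` and propagate off the chart
(`ℓ_{k+1} i = λ_k ℓ_k i`, `i ≠ j k`).  If `ℓ_{k₁}` vanishes at a free letter of time `k₁`, then at every `k ≥ k₁` the
form `ℓ_k` vanishes at a free letter of time `k` (slot step: the free letter is kept; rotation losing `L`: the
direction equation gives `ℓ_k L = 0`, and `L` is the new free letter). [OURS] -/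
theorem lSector_persists_rot [DecidableEq K] (q : ℕ) {c : ℕ → State K} {j : ℕ → Fin 4} {b : ℕ → Fin 4 → K}
    (hw : FreeTail.IsWitnessedChain q c j b) {k₁ : ℕ}
    (ho : ∀ k, k₁ ≤ k → ordZero (c k).F = ((q + 1 : ℕ) : ℕ∞))
    (hwt : ∀ k, k₁ ≤ k → (∀ i, (c k).r i ≤ 1) ∧ (c k).r.degree = 3) {ν : Fin 4}
    (hidle : ∀ k, k₁ ≤ k → 1 ≤ (c k).r ν ∧ j k ≠ ν ∧ b k ν = 0) {ℓ : ℕ → Fin 4 → K} {lam : ℕ → K}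
    (hdir : ∀ k, k₁ ≤ k → ℓ k (j k) + dotProduct (ℓ k) (b k) = 0)
    (hprop : ∀ k, k₁ ≤ k → ∀ i, i ≠ j k → ℓ (k + 1) i = lam k * ℓ k i)
    (hL : ∃ f, (c k₁).r f = 0 ∧ ℓ k₁ f = 0) :
    ∀ k, k₁ ≤ k → ∃ f, (c k).r f = 0 ∧ ℓ k f = 0 := by
  intro k hk
  induction k, hk using Nat.le_induction with
  | base => exact hL
  | succ k hk ih =>
    obtain ⟨f, hrf, hℓf⟩ := ih
    have hν1 : (c k).r ν = 1 := le_antisymm ((hwt k hk).1 ν) (hidle k hk).1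
    obtain ⟨A, B, f', hAB, hAν, hAf, hBν, hBf, hνf, hrABν⟩ := exists_slot_letters (hwt k hk).1 (hwt k hk).2 hν1
    have hff' : f = f' := eq_free_of_apply_eq_zero hAB hAν hAf hBν hBf hνf hrABν hrf
    subst hff'
    have hdeg : (c (k + 1)).r.degree = (c k).r.degree := by rw [(hwt (k + 1) (by omega)).2, (hwt k hk).2]
    rcases slot_or_free hAB hAν hAf hBν hBf hνf (hidle k hk).2.1 with hjk | hjk
    · -- slot step: the free letter is kept
      obtain ⟨hr', -⟩ := r_succ_of_slot' q hw (ho k hk) hdeg hAB hAν hAf hBν hBf hνf hrABν hjk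
      have hjf : j k ≠ f := by
        rcases hjk with h | h
        · rw [h]; exact hAf
        · rw [h]; exact hBf
      refine ⟨f, by rw [hr', (triple_apply hAB hAν hAf hBν hBf hνf).2.2.2], ?_⟩
      rw [hprop k hk f hjf.symm, hℓf, mul_zero]
    · -- rotation: the lost slot is the new free letter, and the direction equation kills `ℓ` there
      have hd := hdir k hk
      rw [hjk, hℓf, zero_add] at hd
      rcases r_succ_of_rotation q hw (ho k hk) hdeg hAB hAν hAf hBν hBf hνf hrABν hjk (hidle k hk).2.2 with
        ⟨hbA, hbs, hr'⟩ | ⟨hbB, hbs, hr'⟩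
      · rw [hbs, dotProduct_single] at hd
        have hℓA : ℓ k A = 0 := by
          rcases mul_eq_zero.mp hd with h | h
          · exact h
          · exact absurd h hbA
        refine ⟨A, ?_, ?_⟩
        · rw [hr', (triple_apply hBf.symm hνf.symm hAf.symm hBν hAB.symm hAν.symm).2.2.2]
        · rw [hprop k hk A (by rw [hjk]; exact hAf), hℓA, mul_zero]
      · rw [hbs, dotProduct_single] at hd
        have hℓB : ℓ k B = 0 := by
          rcases mul_eq_zero.mp hd with h | h
          · exact h
          · exact absurd h hbB
        refine ⟨B, ?_, ?_⟩
        · rw [hr', (triple_apply hAf.symm hνf.symm hBf.symm hAν hAB hBν.symm).2.2.2]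
        · rw [hprop k hk B (by rw [hjk]; exact hBf), hℓB, mul_zero]

end ResCone

end Summit.ResolutionOfSingularities.ResolutionOfSingularities.Theorems.PIDim4

end
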